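import Literature.Analysis.Matrix.SchoenbergKernels
import Mathlib.LinearAlgebra.Finsupp.LinearCombination
import HarnessLib

/-!
# Bounded negative definite functions on abelian groups: `sup ψ − ψ` is positive definite
(Berg–Christensen–Ressel 1984, Ch. 4 Prop. 3.15 — corrected statement, fully proved)

Companion ("Proofs") file of `BoundedNegDefFunctions.lean`, which vendors BCR Prop. 4.3.15 as the
named fact `BergChristensenRessel1984_prop_4_3_15` — a statement that is FALSE as printed (see the
erratum and `not_BergChristensenRessel1984_prop_4_3_15` there: the printed proof's
"WLOG `ψ(0) = 0`" is invalid for the mass bound `μ(Ŝ∖{1}) ≤ ‖ψ‖_∞`; counterexample on `ℤ/3`).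
This file PROVES what the printed argument actually establishes, for abelian groups and real
(even) functions, in the kernel language of `SchoenbergKernels.lean`:

* `isPosDefKernel_const_sub_of_isNegDefKernel` — if `(x, y) ↦ ψ (y − x)` is a negative definite
  kernel on an abelian group `G` and `ψ ≤ B`, then `(x, y) ↦ B − ψ (y − x)` is a positive
  definite kernel.  (BCR: "in particular `ψ` has the form `c − φ` where `c ∈ ℝ` and
  `φ ∈ 𝒫ᵇ(S)`"; here with the sharp information `c` = any upper bound of `ψ`.)
* `BergChristensenRessel1984_prop_4_3_15_corrected` — the tree's rendering of Prop. 4.3.15 with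
  the mass bound corrected to `m ≤ ⨆ s, |ψ s − ψ 0|` (`= ‖ψ − ψ(0)‖_∞`, the bound the printed proof
  yields once the WLOG is undone).
* `BergChristensenRessel1984_prop_4_3_15_of_nonneg` — the printed conclusion verbatim
  (`m ≤ ⨆ s, |ψ s|`) under the extra hypothesis `0 ≤ ψ 0`, the range in which the printed WLOG is
  legitimate (then `‖ψ − ψ(0)‖_∞ ≤ ‖ψ‖_∞` by Cor. 4.3.2).

## Source and proof architecture

C. Berg, J. P. R. Christensen, P. Ressel, *Harmonic Analysis on Semigroups*, GTM 100, Springer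
1984 [BergChristensenRessel1984], Ch. 4 §3, Prop. 3.15 (PDF p. 105, read).  The printed proof
goes through the convolution semigroup `(μ_t)` on `Ŝ` with `μ̂_t = e^{−tψ}`, the Lévy measure
`μ = lim (1/t) μ_t|(Ŝ∖{1})` (Lemma 3.12) and Fatou; Mathlib has neither Bochner–Herglotz on
discrete abelian groups nor Lévy measures, so the measure-theoretic route is not available.
We prove the same statement by the classical MEASURE-FREE argument (Schoenberg/GNS embedding +
circumcentre of the bounded orbit; cf. BCR Ch. 3 Prop. 3.2 for the embedding), organised so
that no Hilbert-space completion is needed either — only `ε`-approximate circumcentres inside the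
algebraic pre-Hilbert space:

1. (`BoundedNegDef.form_*`) On `V = G →₀ ℝ` let `Φ(δ_s, δ_t) = −ψ(t − s)/2` (bilinear,
   symmetric as `ψ` is even) and `ℓ` = total mass.  Negative definiteness of `ψ` says exactly
   `q(w) := Φ(w, w) ≥ 0` whenever `ℓ w = 0`; with `ψ 0 = 0`, `q(δ_t − δ_s) = ψ(t − s)`: the
   "points" `δ_t` (mass one) sit at mutual squared distances `ψ(t − s)` and the translations
   `τ_a` of `G` act on them isometrically (`form_shift`).
2. (`BoundedNegDef.exists_near_center`) Let `R(f) = sup_t q(f − δ_t)` (finite for mass-one `f`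
   since `ψ ≤ B`) and `R* = inf_{ℓ f = 1} R(f) ≤ R(δ_0) ≤ B`.  For `f` with `R(f) < R* + η²`:
   (i) midpoint convexity (`bilin_convex_identity` at `1/2`) and the minimality of `R*` give
   `q(f − τ_a f) ≤ 4η²` for every `a` (approximate fixed point); (ii) hence, by translation
   invariance and a square-root-free Cauchy–Schwarz (`bilin_abs_sub_le`), `f` is almost
   equidistant from all `δ_t`: `|q(f − δ_t) − r₀| ≤ (B + 9)η`, `r₀ = q(f − δ_0)`; (iii) testing
   `R` at `(1 − η)f + ηδ_0` (`bilin_convex_identity` at `η`) gives the radius bound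
   `2 r₀ ≤ B + η(B + 2)`.  (In Hilbert-space terms: the circumcentre `v` of the orbit is a fixed
   point of the affine isometric action, `ψ(t) = ‖v − π(t)v‖² = 2‖v‖² − 2⟨π(t)v, v⟩`, and
   minimality of the circumradius along the segment `[v, 0]` forces `inf_t ⟨π(t)v, v⟩ ≤ 0`,
   i.e. `2‖v‖² ≤ sup ψ`.)
3. (`BoundedNegDef.core`) For any `u` of mass `σ`,
   `−2q(u) = 2σ Σ_s u_s q(f − δ_s) − 2q(u − σf) ≤ 2σ² r₀ + 2|σ| ‖u‖₁ (B + 9)η ≤ σ²B + ηC`, and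
   `η → 0` gives `Σ_{j,k} c_j c_k ψ(x_k − x_j) = −2q(u) ≤ B (Σ c)²` for `u = Σ c_j δ_{x_j}`.
4. (`isPosDefKernel_const_sub_of_isNegDefKernel`) transport between `Fin`-indexed test vectors
   and finitely supported functions, and the shift `ψ ↦ ψ − ψ 0`.

The translation invariance (group structure) is load-bearing: for negative definite KERNELS the
statement fails (squared distances of `−1, 0, 1`), cf. the route note on item
`BoundedNegDefPosDef` of `CriticalPhenomena/PercolationContinuityZ3/PercLevyKhintchine`, which is
the `ψ 0 = 0`, `G = ℤ³` instance of `isPosDefKernel_const_sub_of_isNegDefKernel`.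

NOT here: the Lévy measure / integral representation itself, complex-valued functions, general
`*`-semigroups.
-/

noncomputable section

open scoped BigOperators
open Finsupp (single)

namespace Literature.Analysis.Matrix

namespace BoundedNegDef

section Bilinear

variable {V : Type*} [AddCommGroup V] [Module ℝ V] (Φ : V →ₗ[ℝ] V →ₗ[ℝ] ℝ)

/-- Convex-combination identity for a symmetric bilinear form:
`q((1−δ)p + δq − o) = (1−δ) q(p−o) + δ q(q−o) − δ(1−δ) q(p−q)` with `q(v) = Φ(v,v)`. [folklore] -/
theorem bilin_convex_identity (hsym : ∀ u v, Φ u v = Φ v u) (p q o : V) (δ : ℝ) :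
    Φ ((1 - δ) • p + δ • q - o) ((1 - δ) • p + δ • q - o)
      = (1 - δ) * Φ (p - o) (p - o) + δ * Φ (q - o) (q - o)
          - δ * (1 - δ) * Φ (p - q) (p - q) := by
  simp only [map_add, map_sub, map_smul, LinearMap.add_apply, LinearMap.sub_apply,
    LinearMap.smul_apply, smul_eq_mul]
  rw [hsym q p, hsym o p, hsym o q]
  ring

/-- Parallelogram law for the quadratic form of a bilinear form. [folklore] -/
theorem bilin_parallelogram (a b : V) :
    Φ (a + b) (a + b) + Φ (a - b) (a - b) = 2 * Φ a a + 2 * Φ b b := by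
  simp only [map_add, map_sub, LinearMap.add_apply, LinearMap.sub_apply]
  ring

/-- Expansion of `q(μa + b)` for a symmetric bilinear form. [folklore] -/
theorem bilin_smul_add (hsym : ∀ u v, Φ u v = Φ v u) (a b : V) (μ : ℝ) :
    Φ (μ • a + b) (μ • a + b) = μ ^ 2 * Φ a a + 2 * μ * Φ a b + Φ b b := by
  simp only [map_add, map_smul, LinearMap.add_apply, LinearMap.smul_apply, smul_eq_mul]
  rw [hsym b a]
  ring

/-- Expansion of `q(μa − b)` for a symmetric bilinear form. [folklore] -/
theorem bilin_smul_sub (hsym : ∀ u v, Φ u v = Φ v u) (a b : V) (μ : ℝ) :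
    Φ (μ • a - b) (μ • a - b) = μ ^ 2 * Φ a a - 2 * μ * Φ a b + Φ b b := by
  simp only [map_sub, map_smul, LinearMap.sub_apply, LinearMap.smul_apply, smul_eq_mul]
  rw [hsym b a]
  ring

/-- Expansion of `q(a − μb)` for a symmetric bilinear form. [folklore] -/
theorem bilin_sub_smul (hsym : ∀ u v, Φ u v = Φ v u) (a b : V) (μ : ℝ) :
    Φ (a - μ • b) (a - μ • b) = Φ a a - 2 * μ * Φ a b + μ ^ 2 * Φ b b := by
  simp only [map_sub, map_smul, LinearMap.sub_apply, LinearMap.smul_apply, smul_eq_mul]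
  rw [hsym b a]
  ring

/-- `q(a + b) ≤ 2q(a) + 2q(b)` for a form positive semidefinite on `ker ℓ ∋ a, b`. [folklore] -/
theorem bilin_add_le (ℓ : V →ₗ[ℝ] ℝ) (hpsd : ∀ w, ℓ w = 0 → 0 ≤ Φ w w) (a b : V)
    (ha : ℓ a = 0) (hb : ℓ b = 0) :
    Φ (a + b) (a + b) ≤ 2 * Φ a a + 2 * Φ b b := by
  have h := bilin_parallelogram Φ a b
  have h' : 0 ≤ Φ (a - b) (a - b) := hpsd _ (by simp [ha, hb])
  linarith

/-- Square-root-free Cauchy–Schwarz: `|q(a+b) − q(b)| ≤ (1+μ) q(a) + q(b)/μ` (`μ > 0`) for a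
symmetric form positive semidefinite on `ker ℓ ∋ a, b`. [folklore] -/
theorem bilin_abs_sub_le (hsym : ∀ u v, Φ u v = Φ v u) (ℓ : V →ₗ[ℝ] ℝ)
    (hpsd : ∀ w, ℓ w = 0 → 0 ≤ Φ w w) (a b : V) (ha : ℓ a = 0) (hb : ℓ b = 0)
    {μ : ℝ} (hμ : 0 < μ) :
    |Φ (a + b) (a + b) - Φ b b| ≤ (1 + μ) * Φ a a + Φ b b / μ := by
  have h1 : 0 ≤ Φ (μ • a + b) (μ • a + b) := hpsd _ (by simp [ha, hb])
  have h2 : 0 ≤ Φ (μ • a - b) (μ • a - b) := hpsd _ (by simp [ha, hb])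
  have ha0 : 0 ≤ Φ a a := hpsd a ha
  have hb0 : 0 ≤ Φ b b := hpsd b hb
  rw [bilin_smul_add Φ hsym] at h1
  rw [bilin_smul_sub Φ hsym] at h2
  have hab : Φ (a + b) (a + b) = Φ a a + 2 * Φ a b + Φ b b := by
    simpa using bilin_smul_add Φ hsym a b 1
  have hup : 2 * Φ a b ≤ μ * Φ a a + Φ b b / μ := by
    rw [← sub_nonneg]
    have : μ * Φ a a + Φ b b / μ - 2 * Φ a b
        = (μ ^ 2 * Φ a a - 2 * μ * Φ a b + Φ b b) / μ := by
      field_simp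
      ring
    rw [this]
    exact div_nonneg h2 hμ.le
  have hlo : -(2 * Φ a b) ≤ μ * Φ a a + Φ b b / μ := by
    rw [← sub_nonneg]
    have : μ * Φ a a + Φ b b / μ - -(2 * Φ a b)
        = (μ ^ 2 * Φ a a + 2 * μ * Φ a b + Φ b b) / μ := by
      field_simp
      ring
    rw [this]
    exact div_nonneg h1 hμ.le
  rw [hab, abs_le]
  constructor <;> nlinarith

end Bilinear

section Core

variable {G : Type*} [AddCommGroup G] (ψ : G → ℝ)
  (Φ : (G →₀ ℝ) →ₗ[ℝ] (G →₀ ℝ) →ₗ[ℝ] ℝ) (ℓ : (G →₀ ℝ) →ₗ[ℝ] ℝ)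

/-- The form `Φ(δ_s, δ_t) = −ψ(t−s)/2` is symmetric when `ψ` is even. [folklore] -/
theorem form_comm
    (hΦ : ∀ s t a b, Φ (single s a) (single t b) = -(a * b * ψ (t - s)) / 2)
    (heven : ∀ s, ψ (-s) = ψ s) (u v : G →₀ ℝ) : Φ u v = Φ v u := by
  induction u using Finsupp.induction_linear with
  | zero => simp
  | add u₁ u₂ h₁ h₂ => simp only [map_add, LinearMap.add_apply, h₁, h₂]
  | single s a =>
    induction v using Finsupp.induction_linear with
    | zero => simp
    | add v₁ v₂ h₁ h₂ => simp only [map_add, LinearMap.add_apply, h₁, h₂]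
    | single t b =>
      rw [hΦ, hΦ, ← neg_sub t s, heven]
      ring

/-- Translations `τ_a = (s ↦ s + a)_*` preserve the form `Φ(δ_s, δ_t) = −ψ(t−s)/2`. [folklore] -/
theorem form_shift
    (hΦ : ∀ s t a b, Φ (single s a) (single t b) = -(a * b * ψ (t - s)) / 2)
    (a : G) (u v : G →₀ ℝ) :
    Φ (Finsupp.lmapDomain ℝ ℝ (fun s => s + a) u) (Finsupp.lmapDomain ℝ ℝ (fun s => s + a) v)
      = Φ u v := by
  induction u using Finsupp.induction_linear with
  | zero => simp
  | add u₁ u₂ h₁ h₂ => simp only [map_add, LinearMap.add_apply, h₁, h₂]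
  | single s x =>
    induction v using Finsupp.induction_linear with
    | zero => simp
    | add v₁ v₂ h₁ h₂ => simp only [map_add, h₁, h₂]
    | single t y =>
      simp only [Finsupp.lmapDomain_apply, Finsupp.mapDomain_single, hΦ, add_sub_add_right_eq_sub]

/-- Translations preserve the total mass. [folklore] -/
theorem mass_shift (hℓ : ∀ s a, ℓ (single s a) = a) (a : G) (u : G →₀ ℝ) :
    ℓ (Finsupp.lmapDomain ℝ ℝ (fun s => s + a) u) = ℓ u := by
  induction u using Finsupp.induction_linear with
  | zero => simp
  | add u₁ u₂ h₁ h₂ => simp only [map_add, h₁, h₂]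
  | single s x => simp only [Finsupp.lmapDomain_apply, Finsupp.mapDomain_single, hℓ]

/-- Squared distance of two points: `q(δ_t − δ_s) = ψ(t − s)` when `ψ 0 = 0`, `ψ` even. [folklore] -/
theorem form_single_sub_single
    (hΦ : ∀ s t a b, Φ (single s a) (single t b) = -(a * b * ψ (t - s)) / 2)
    (heven : ∀ s, ψ (-s) = ψ s) (h0 : ψ 0 = 0) (s t : G) :
    Φ (single t 1 - single s 1) (single t 1 - single s 1) = ψ (t - s) := by
  simp only [map_sub, LinearMap.sub_apply, hΦ, sub_self, h0]
  rw [← neg_sub t s, heven]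
  ring

/-- The form on finite combinations of points: `Φ(Σ c_j δ_{x_j}, Σ c_k δ_{x_k}) = Σ_{j,k} −c_j c_k ψ(x_k − x_j)/2`.
[folklore] -/
theorem form_sum_single
    (hΦ : ∀ s t a b, Φ (single s a) (single t b) = -(a * b * ψ (t - s)) / 2)
    {ι : Type*} (S : Finset ι) (x : ι → G) (c : ι → ℝ) :
    Φ (∑ j ∈ S, single (x j) (c j)) (∑ k ∈ S, single (x k) (c k))
      = ∑ j ∈ S, ∑ k ∈ S, -(c j * c k * ψ (x k - x j)) / 2 := by
  simp only [map_sum, LinearMap.sum_apply, hΦ]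
  exact Finset.sum_comm

omit [AddCommGroup G] in
/-- Total mass of a finite combination of points. [folklore] -/
theorem mass_sum_single (hℓ : ∀ s a, ℓ (single s a) = a)
    {ι : Type*} (S : Finset ι) (x : ι → G) (c : ι → ℝ) :
    ℓ (∑ j ∈ S, single (x j) (c j)) = ∑ j ∈ S, c j := by
  simp only [map_sum, hℓ]

/-- `Σ_s u_s q(f − δ_s) = −2 Φ(u, f) + ℓ(u) q(f)` (when `ψ 0 = 0`): the weighted sum of squared
distances from `f` to the points, linear in the weights `u`. [folklore] -/
theorem form_lin_identity
    (hΦ : ∀ s t a b, Φ (single s a) (single t b) = -(a * b * ψ (t - s)) / 2)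
    (hℓ : ∀ s a, ℓ (single s a) = a) (hsym : ∀ u v, Φ u v = Φ v u) (h0 : ψ 0 = 0)
    (f u : G →₀ ℝ) :
    Finsupp.linearCombination ℝ (fun s => Φ (f - single s 1) (f - single s 1)) u
      = -2 * Φ u f + ℓ u * Φ f f := by
  induction u using Finsupp.induction_linear with
  | zero => simp
  | add u₁ u₂ h₁ h₂ =>
    simp only [map_add, LinearMap.add_apply, h₁, h₂]
    ring
  | single s a =>
    rw [Finsupp.linearCombination_single, smul_eq_mul, ← Finsupp.smul_single_one s a, map_smul,
      map_smul, LinearMap.smul_apply, smul_eq_mul, smul_eq_mul, hℓ]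
    simp only [map_sub, LinearMap.sub_apply, hΦ, sub_self, h0]
    rw [hsym f (single s 1)]
    ring


/-- **Approximate circumcentre of the orbit.** For `η ∈ (0, 1]` there is a mass-one `f` whose
squared distances `q(f − δ_t)` to ALL points are within `(B + 9)η` of `r₀ = q(f − δ_0)`, with
`2 r₀ ≤ B + η(B + 2)` — steps (i)–(iii) of the module doc (approximate minimiser of the
eccentricity `R(f) = sup_t q(f − δ_t)`; approximate fixed point of all translations; radius bound
from the test point `(1 − η)f + ηδ_0`). [folklore] -/
theorem exists_near_center
    (hΦ : ∀ s t a b, Φ (single s a) (single t b) = -(a * b * ψ (t - s)) / 2)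
    (hℓ : ∀ s a, ℓ (single s a) = a) (h0 : ψ 0 = 0) (heven : ∀ s, ψ (-s) = ψ s)
    (hnd : ∀ w, ℓ w = 0 → 0 ≤ Φ w w) {B : ℝ} (hB : ∀ s, ψ s ≤ B)
    {η : ℝ} (hη : 0 < η) (hη1 : η ≤ 1) :
    ∃ f : G →₀ ℝ, ℓ f = 1 ∧
      2 * Φ (f - single 0 1) (f - single 0 1) ≤ B + η * (B + 2) ∧
      ∀ t, |Φ (f - single t 1) (f - single t 1) - Φ (f - single 0 1) (f - single 0 1)|
        ≤ (B + 9) * η := by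
  have hsym : ∀ u v, Φ u v = Φ v u := form_comm ψ Φ hΦ heven
  have hB0 : 0 ≤ B := by simpa [h0] using hB 0
  have hqδ : ∀ s t, Φ (single t 1 - single s 1) (single t 1 - single s 1) = ψ (t - s) :=
    form_single_sub_single ψ Φ hΦ heven h0
  have hℓδ : ∀ t, ℓ (single t 1) = (1 : ℝ) := fun t => hℓ t 1
  -- translations `τ a = (s ↦ s + a)_*`
  obtain ⟨τ, hτ⟩ : ∃ τ : G → (G →₀ ℝ) →ₗ[ℝ] (G →₀ ℝ),
      ∀ a, τ a = Finsupp.lmapDomain ℝ ℝ (fun s => s + a) := ⟨_, fun a => rfl⟩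
  have hτsingle : ∀ a s (x : ℝ), τ a (single s x) = single (s + a) x := fun a s x => by
    rw [hτ, Finsupp.lmapDomain_apply, Finsupp.mapDomain_single]
  have hτΦ : ∀ a u v, Φ (τ a u) (τ a v) = Φ u v := fun a u v => by
    rw [hτ]; exact form_shift ψ Φ hΦ a u v
  have hτℓ : ∀ a u, ℓ (τ a u) = ℓ u := fun a u => by
    rw [hτ]; exact mass_shift ℓ hℓ a u
  -- the eccentricity `R g = sup_t q(g - δ_t)`
  obtain ⟨R, hR⟩ : ∃ R : (G →₀ ℝ) → ℝ,
      ∀ g, R g = ⨆ t, Φ (g - single t 1) (g - single t 1) := ⟨_, fun g => rfl⟩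
  have hbdd : ∀ g, ℓ g = 1 →
      BddAbove (Set.range fun t => Φ (g - single t 1) (g - single t 1)) := by
    intro g hg
    refine ⟨2 * Φ (g - single 0 1) (g - single 0 1) + 2 * B, ?_⟩
    rintro _ ⟨t, rfl⟩
    have hsplit : g - single t 1 = (g - single 0 1) + (single 0 1 - single t 1) :=
      (sub_add_sub_cancel _ _ _).symm
    have h1 := bilin_add_le Φ ℓ hnd (g - single 0 1) (single 0 1 - single t 1)
      (by simp [hg, hℓδ]) (by simp [hℓδ])
    have h2 : Φ (single 0 1 - single t 1) (single 0 1 - single t 1) = ψ t := by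
      rw [hqδ, zero_sub, heven]
    dsimp only
    rw [hsplit]
    linarith [hB t]
  have hRge : ∀ g, ℓ g = 1 → ∀ t, Φ (g - single t 1) (g - single t 1) ≤ R g := by
    intro g hg t
    rw [hR]
    exact le_ciSup (hbdd g hg) t
  have hRle : ∀ g (C : ℝ), (∀ t, Φ (g - single t 1) (g - single t 1) ≤ C) → R g ≤ C := by
    intro g C h
    rw [hR]
    exact ciSup_le h
  -- `R* = inf` over the points of mass one
  have hne : (R '' {g | ℓ g = 1}).Nonempty := ⟨R (single 0 1), single 0 1, hℓδ 0, rfl⟩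
  have hbb : BddBelow (R '' {g | ℓ g = 1}) := by
    refine ⟨0, ?_⟩
    rintro _ ⟨g, hg, rfl⟩
    have hg : ℓ g = 1 := hg
    exact (hnd _ (by simp [hg, hℓδ])).trans (hRge g hg 0)
  have hinf_le : ∀ g, ℓ g = 1 → sInf (R '' {g | ℓ g = 1}) ≤ R g := fun g hg =>
    csInf_le hbb ⟨g, hg, rfl⟩
  have hinfB : sInf (R '' {g | ℓ g = 1}) ≤ B :=
    (hinf_le _ (hℓδ 0)).trans (hRle _ _ fun t => by rw [hqδ, zero_sub, heven]; exact hB t)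
  -- an `η²`-approximate minimiser `f` of `R`
  obtain ⟨_, ⟨f, hf, rfl⟩, hfR⟩ := Real.lt_sInf_add_pos hne (pow_pos hη 2)
  have hf : ℓ f = 1 := hf
  have hr0R : Φ (f - single 0 1) (f - single 0 1) ≤ R f := hRge f hf 0
  have hr0 : 0 ≤ Φ (f - single 0 1) (f - single 0 1) := hnd _ (by simp [hf, hℓδ])
  have hη2 : η ^ 2 ≤ η := by nlinarith
  have hRfB : R f < B + 1 := by linarith
  -- (i) `f` is an approximate fixed point of every translation
  have hfix : ∀ a, Φ (f - τ a f) (f - τ a f) < 4 * η ^ 2 := by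
    intro a
    have hm : ℓ ((1 - (1 / 2 : ℝ)) • f + (1 / 2 : ℝ) • τ a f) = 1 := by
      simp only [map_add, map_smul, smul_eq_mul, hf, hτℓ]; ring
    have hτt : ∀ t, Φ (τ a f - single t 1) (τ a f - single t 1) ≤ R f := by
      intro t
      have : τ a f - single t 1 = τ a (f - single (t - a) 1) := by
        rw [map_sub, hτsingle, sub_add_cancel]
      rw [this, hτΦ]
      exact hRge f hf (t - a)
    have hmR : R ((1 - (1 / 2 : ℝ)) • f + (1 / 2 : ℝ) • τ a f)
        ≤ R f - Φ (f - τ a f) (f - τ a f) / 4 := by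
      refine hRle _ _ fun t => ?_
      rw [bilin_convex_identity Φ hsym f (τ a f) (single t 1) (1 / 2)]
      have h1 := hRge f hf t
      have h2 := hτt t
      linarith
    have h3 := hinf_le _ hm
    linarith
  -- (ii) `f` is almost equidistant from all the points `δ_t`
  have hnear : ∀ t, |Φ (f - single t 1) (f - single t 1)
      - Φ (f - single 0 1) (f - single 0 1)| ≤ (B + 9) * η := by
    intro t
    have hsplit : f - single t 1 = (f - τ t f) + τ t (f - single 0 1) := by
      rw [map_sub, hτsingle, zero_add, sub_add_sub_cancel]
    have hb : Φ (τ t (f - single 0 1)) (τ t (f - single 0 1))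
        = Φ (f - single 0 1) (f - single 0 1) := hτΦ t _ _
    have hμ : (0 : ℝ) < 1 / η := by positivity
    have key := bilin_abs_sub_le Φ hsym ℓ hnd (f - τ t f) (τ t (f - single 0 1))
      (by simp [hf, hτℓ]) (by simp [hτℓ, hf, hℓδ]) hμ
    rw [← hsplit, hb] at key
    have ha := hfix t
    have hη0 : η ≠ 0 := hη.ne'
    have e1 : (1 + 1 / η) * Φ (f - τ t f) (f - τ t f) ≤ (1 + 1 / η) * (4 * η ^ 2) :=
      mul_le_mul_of_nonneg_left ha.le (by positivity)
    have e2 : (1 + 1 / η) * (4 * η ^ 2) = 4 * η ^ 2 + 4 * η := by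
      calc (1 + 1 / η) * (4 * η ^ 2) = 4 * η ^ 2 + 4 * η * (η / η) := by ring
        _ = 4 * η ^ 2 + 4 * η := by rw [div_self hη0, mul_one]
    have e3 : Φ (f - single 0 1) (f - single 0 1) / (1 / η)
        = η * Φ (f - single 0 1) (f - single 0 1) := by
      rw [div_div_eq_mul_div, div_one, mul_comm]
    have e4 : η * Φ (f - single 0 1) (f - single 0 1) ≤ η * (B + 1) :=
      mul_le_mul_of_nonneg_left (by linarith) hη.le
    rw [e3] at key
    linarith
  -- (iii) the radius bound: test point `(1 - η) f + η δ_0`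
  have hrad : 2 * Φ (f - single 0 1) (f - single 0 1) ≤ B + η * (B + 2) := by
    have hg : ℓ ((1 - η) • f + η • single 0 1) = 1 := by
      simp only [map_add, map_smul, smul_eq_mul, hf, hℓδ]; ring
    have hRg : R ((1 - η) • f + η • single 0 1)
        ≤ (1 - η) * R f + η * B - η * (1 - η) * Φ (f - single 0 1) (f - single 0 1) := by
      refine hRle _ _ fun t => ?_
      rw [bilin_convex_identity Φ hsym f (single 0 1) (single t 1) η]
      have h1 : Φ (f - single t 1) (f - single t 1) ≤ R f := hRge f hf t
      have h2 : Φ (single 0 1 - single t 1) (single 0 1 - single t 1) ≤ B := by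
        rw [hqδ, zero_sub, heven]; exact hB t
      have h1' := mul_le_mul_of_nonneg_left h1 (by linarith : (0 : ℝ) ≤ 1 - η)
      have h2' := mul_le_mul_of_nonneg_left h2 hη.le
      linarith
    have h3 := hinf_le _ hg
    have hZ : η * (R f + Φ (f - single 0 1) (f - single 0 1)
        - η * Φ (f - single 0 1) (f - single 0 1) - B - η) < 0 := by
      linarith
    have hZ' : R f + Φ (f - single 0 1) (f - single 0 1)
        - η * Φ (f - single 0 1) (f - single 0 1) - B - η < 0 := by
      by_contra hcon
      have := mul_nonneg hη.le (not_lt.mp hcon)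
      linarith
    have e6 : η * Φ (f - single 0 1) (f - single 0 1) ≤ η * (B + 1) :=
      mul_le_mul_of_nonneg_left (by linarith) hη.le
    linarith
  exact ⟨f, hf, hrad, hnear⟩


/-- **Core inequality** (finsupp form of "`B − ψ` is positive definite", `ψ 0 = 0`): for every
finitely supported `u`, `0 ≤ B ℓ(u)² + 2 Φ(u, u)`, i.e. `Σ_{s,t} u_s u_t ψ(t − s) ≤ B (Σ u)²`.
Step 3 of the module doc. [folklore] -/
theorem core
    (hΦ : ∀ s t a b, Φ (single s a) (single t b) = -(a * b * ψ (t - s)) / 2)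
    (hℓ : ∀ s a, ℓ (single s a) = a) (h0 : ψ 0 = 0) (heven : ∀ s, ψ (-s) = ψ s)
    (hnd : ∀ w, ℓ w = 0 → 0 ≤ Φ w w) {B : ℝ} (hB : ∀ s, ψ s ≤ B) (u : G →₀ ℝ) :
    0 ≤ B * (ℓ u) ^ 2 + 2 * Φ u u := by
  have hsym : ∀ u v, Φ u v = Φ v u := form_comm ψ Φ hΦ heven
  have hB0 : 0 ≤ B := by simpa [h0] using hB 0
  have hℓδ : ∀ t, ℓ (single t 1) = (1 : ℝ) := fun t => hℓ t 1
  -- `ℓ u` as a sum over the support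
  have hℓu : ℓ u = ∑ s ∈ u.support, u s := by
    conv_lhs => rw [← Finsupp.sum_single u]
    simp only [Finsupp.sum, map_sum, hℓ]
  refine le_of_forall_pos_le_add fun ε hε => ?_
  set N := ∑ s ∈ u.support, |u s| with hN
  have hN0 : 0 ≤ N := Finset.sum_nonneg fun s _ => abs_nonneg _
  set C := (ℓ u) ^ 2 * (B + 2) + 2 * |ℓ u| * N * (B + 9) with hC
  have hC0 : 0 ≤ C := by positivity
  -- choose `η ∈ (0, 1]` with `η C ≤ ε`
  obtain ⟨η, hη, hη1, hηC⟩ : ∃ η : ℝ, 0 < η ∧ η ≤ 1 ∧ η * C ≤ ε := by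
    refine ⟨min 1 (ε / (C + 1)), lt_min one_pos (by positivity), min_le_left _ _, ?_⟩
    calc min 1 (ε / (C + 1)) * C ≤ ε / (C + 1) * C :=
          mul_le_mul_of_nonneg_right (min_le_right _ _) hC0
      _ ≤ ε := by
          rw [div_mul_eq_mul_div, div_le_iff₀ (by positivity)]
          nlinarith
  obtain ⟨f, hf, hrad, hnear⟩ := exists_near_center ψ Φ ℓ hΦ hℓ h0 heven hnd hB hη hη1
  -- the key identity `-2 q(u) = 2σ Σ_s u_s q(f - δ_s) - 2 q(u - σ f)`, `σ = ℓ u`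
  have hL := form_lin_identity ψ Φ ℓ hΦ hℓ hsym h0 f u
  rw [Finsupp.linearCombination_apply] at hL
  simp only [Finsupp.sum, smul_eq_mul] at hL
  have hpos : 0 ≤ Φ (u - ℓ u • f) (u - ℓ u • f) := hnd _ (by simp [hf])
  have hexp := bilin_sub_smul Φ hsym u f (ℓ u)
  have hmain : -2 * Φ u u
      ≤ 2 * ℓ u * ∑ s ∈ u.support, u s * Φ (f - single s 1) (f - single s 1) := by
    rw [hL]
    linarith
  -- deviation from `σ r₀`
  have hdev : |∑ s ∈ u.support, u s * Φ (f - single s 1) (f - single s 1)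
      - ℓ u * Φ (f - single 0 1) (f - single 0 1)| ≤ N * ((B + 9) * η) := by
    rw [hℓu, Finset.sum_mul, ← Finset.sum_sub_distrib]
    calc |∑ s ∈ u.support, (u s * Φ (f - single s 1) (f - single s 1)
            - u s * Φ (f - single 0 1) (f - single 0 1))|
        ≤ ∑ s ∈ u.support, |u s * Φ (f - single s 1) (f - single s 1)
            - u s * Φ (f - single 0 1) (f - single 0 1)| := Finset.abs_sum_le_sum_abs _ _
      _ ≤ ∑ s ∈ u.support, |u s| * ((B + 9) * η) := by
          refine Finset.sum_le_sum fun s _ => ?_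
          rw [← mul_sub, abs_mul]
          exact mul_le_mul_of_nonneg_left (hnear s) (abs_nonneg _)
      _ = N * ((B + 9) * η) := by rw [hN, Finset.sum_mul]
  obtain ⟨D, hD, hDdef⟩ : ∃ D, |D| ≤ N * ((B + 9) * η) ∧
      ∑ s ∈ u.support, u s * Φ (f - single s 1) (f - single s 1)
        = ℓ u * Φ (f - single 0 1) (f - single 0 1) + D := ⟨_, hdev, by ring⟩
  rw [hDdef] at hmain
  have h1 : 2 * ℓ u * D ≤ 2 * |ℓ u| * (N * ((B + 9) * η)) := by
    calc 2 * ℓ u * D ≤ |2 * ℓ u * D| := le_abs_self _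
      _ = 2 * |ℓ u| * |D| := by rw [abs_mul, abs_mul, abs_two]
      _ ≤ 2 * |ℓ u| * (N * ((B + 9) * η)) := mul_le_mul_of_nonneg_left hD (by positivity)
  have h2 : (ℓ u) ^ 2 * (2 * Φ (f - single 0 1) (f - single 0 1))
      ≤ (ℓ u) ^ 2 * (B + η * (B + 2)) := mul_le_mul_of_nonneg_left hrad (sq_nonneg _)
  have h3 : η * C = η * ((ℓ u) ^ 2 * (B + 2)) + η * (2 * |ℓ u| * N * (B + 9)) := by
    rw [hC]; ring
  nlinarith [hmain, h1, h2, h3, hηC]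

end Core

section Reindex

variable {G : Type*}

/-- Reindex a sum over a finset by `Fin` of its cardinality. [folklore] -/
theorem sum_finset_eq_fin (S : Finset G) (g : G → ℝ) :
    ∑ s ∈ S, g s = ∑ j : Fin S.card, g (S.equivFin.symm j) := by
  rw [← Finset.sum_coe_sort, ← Equiv.sum_comp S.equivFin.symm]

/-- Reindex a double sum over a finset by `Fin` of its cardinality. [folklore] -/
theorem sum_sum_finset_eq_fin (S : Finset G) (F : G → G → ℝ) :
    ∑ s ∈ S, ∑ t ∈ S, F s t
      = ∑ j : Fin S.card, ∑ k : Fin S.card, F (S.equivFin.symm j) (S.equivFin.symm k) := by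
  rw [sum_finset_eq_fin]
  exact Fintype.sum_congr _ _ fun j => sum_finset_eq_fin _ _

end Reindex

end BoundedNegDef

section Main

open BoundedNegDef

variable {G : Type*} [AddCommGroup G]

/-- **`sup ψ − ψ` is positive definite for a bounded negative definite function on an abelian
group** (Berg–Christensen–Ressel 1984, Ch. 4 Prop. 3.15, the assertion "in particular `ψ` has
the form `c − φ` where `c ∈ ℝ` and `φ ∈ 𝒫ᵇ(S)`", for abelian groups `s* = −s` and real functions,
with `c` = ANY upper bound `B` of `ψ`): if `(x, y) ↦ ψ (y − x)` is a negative definite kernel and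
`ψ ≤ B` then `(x, y) ↦ B − ψ (y − x)` is a positive definite kernel.  Proved measure-free via
approximate circumcentres (module doc); this is the statement the route item
`BoundedNegDefPosDef` (PercLevyKhintchine, `G = ℤ³`, `ψ 0 = 0`) needs.
[cite: BergChristensenRessel1984, Ch. 4 Prop. 3.15 (PDF p. 105)] -/
theorem isPosDefKernel_const_sub_of_isNegDefKernel (ψ : G → ℝ)
    (hψ : IsNegDefKernel fun x y => ψ (y - x)) {B : ℝ} (hB : ∀ s, ψ s ≤ B) :
    IsPosDefKernel fun x y => B - ψ (y - x) := by
  have heven : ∀ s, ψ (-s) = ψ s := fun s => by simpa using hψ.1 s 0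
  -- the centred function `ψ' = ψ - ψ 0`
  obtain ⟨ψ', hψ'⟩ : ∃ ψ' : G → ℝ, ∀ s, ψ' s = ψ s - ψ 0 := ⟨_, fun s => rfl⟩
  have h0' : ψ' 0 = 0 := by rw [hψ', sub_self]
  have heven' : ∀ s, ψ' (-s) = ψ' s := fun s => by rw [hψ', hψ', heven]
  have hB' : ∀ s, ψ' s ≤ B - ψ 0 := fun s => by rw [hψ']; exact sub_le_sub_right (hB s) _
  have hnd' : ∀ (n : ℕ) (x : Fin n → G) (c : Fin n → ℝ), ∑ j, c j = 0 →
      ∑ j, ∑ k, c j * c k * ψ' (x k - x j) ≤ 0 := by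
    intro n x c hc
    have h := hψ.2 n x c hc
    have e : ∑ j, ∑ k, c j * c k * ψ' (x k - x j)
        = ∑ j, ∑ k, c j * c k * ψ (x k - x j) - ψ 0 * ((∑ j, c j) * ∑ k, c k) := by
      rw [Finset.sum_mul_sum, Finset.mul_sum, ← Finset.sum_sub_distrib]
      refine Finset.sum_congr rfl fun j _ => ?_
      rw [Finset.mul_sum, ← Finset.sum_sub_distrib]
      refine Finset.sum_congr rfl fun k _ => ?_
      rw [hψ']
      ring
    rw [e, hc]
    simpa using h
  -- the bilinear form `Φ(δ_s, δ_t) = -ψ'(t - s)/2` and the mass functional `ℓ`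
  obtain ⟨Φ, hΦ⟩ : ∃ Φ : (G →₀ ℝ) →ₗ[ℝ] (G →₀ ℝ) →ₗ[ℝ] ℝ,
      ∀ s t a b, Φ (single s a) (single t b) = -(a * b * ψ' (t - s)) / 2 :=
    ⟨Finsupp.linearCombination ℝ fun s =>
        Finsupp.linearCombination ℝ fun t => -(ψ' (t - s)) / 2,
      fun s t a b => by
        simp only [Finsupp.linearCombination_single, LinearMap.smul_apply, smul_eq_mul]
        ring⟩
  obtain ⟨ℓ, hℓ⟩ : ∃ ℓ : (G →₀ ℝ) →ₗ[ℝ] ℝ, ∀ s a, ℓ (single s a) = a :=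
    ⟨Finsupp.linearCombination ℝ fun _ => 1, fun s a => by simp⟩
  -- negative definiteness in the language of finitely supported functions
  have hnd : ∀ w, ℓ w = 0 → 0 ≤ Φ w w := by
    intro w hw
    have hw' : w = ∑ s ∈ w.support, single s (w s) := (Finsupp.sum_single w).symm
    have hmass : ∑ s ∈ w.support, w s = 0 := by
      rw [← hw]
      conv_rhs => rw [hw']
      exact (mass_sum_single ℓ hℓ w.support (fun s => s) w).symm
    have hΦw : Φ w w = ∑ s ∈ w.support, ∑ t ∈ w.support, -(w s * w t * ψ' (t - s)) / 2 := by
      conv_lhs => rw [hw']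
      exact form_sum_single ψ' Φ hΦ w.support (fun s => s) w
    rw [hΦw, sum_sum_finset_eq_fin]
    rw [sum_finset_eq_fin] at hmass
    have key : ∑ j : Fin w.support.card, ∑ k : Fin w.support.card,
        w (w.support.equivFin.symm j) * w (w.support.equivFin.symm k)
          * ψ' ((w.support.equivFin.symm k : G) - w.support.equivFin.symm j) ≤ 0 :=
      hnd' _ (fun j => (w.support.equivFin.symm j : G))
        (fun j => w (w.support.equivFin.symm j)) hmass
    have e : ∑ j : Fin w.support.card, ∑ k : Fin w.support.card,
        -(w (w.support.equivFin.symm j) * w (w.support.equivFin.symm k)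
          * ψ' ((w.support.equivFin.symm k : G) - w.support.equivFin.symm j)) / 2
        = -(1 / 2) * ∑ j : Fin w.support.card, ∑ k : Fin w.support.card,
            w (w.support.equivFin.symm j) * w (w.support.equivFin.symm k)
              * ψ' ((w.support.equivFin.symm k : G) - w.support.equivFin.symm j) := by
      rw [Finset.mul_sum]
      refine Finset.sum_congr rfl fun j _ => ?_
      rw [Finset.mul_sum]
      refine Finset.sum_congr rfl fun k _ => ?_
      ring
    rw [e]
    nlinarith
  refine ⟨fun x y => ?_, fun n x c => ?_⟩
  · show B - ψ (y - x) = B - ψ (x - y)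
    rw [← neg_sub x y, heven]
  · have key := core ψ' Φ ℓ hΦ hℓ h0' heven' hnd hB' (∑ j, single (x j) (c j))
    rw [mass_sum_single ℓ hℓ, form_sum_single ψ' Φ hΦ] at key
    have e1 : ∑ j, ∑ k, c j * c k * (B - ψ (x k - x j))
        = B * ((∑ j, c j) * ∑ k, c k) - ∑ j, ∑ k, c j * c k * ψ (x k - x j) := by
      rw [Finset.sum_mul_sum, Finset.mul_sum, ← Finset.sum_sub_distrib]
      refine Finset.sum_congr rfl fun j _ => ?_
      rw [Finset.mul_sum, ← Finset.sum_sub_distrib]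
      refine Finset.sum_congr rfl fun k _ => ?_
      ring
    have e2 : 2 * ∑ j, ∑ k, -(c j * c k * ψ' (x k - x j)) / 2
        = -(∑ j, ∑ k, c j * c k * ψ (x k - x j)) + ψ 0 * ((∑ j, c j) * ∑ k, c k) := by
      rw [Finset.sum_mul_sum, Finset.mul_sum, Finset.mul_sum, ← Finset.sum_neg_distrib,
        ← Finset.sum_add_distrib]
      refine Finset.sum_congr rfl fun j _ => ?_
      rw [Finset.mul_sum, Finset.mul_sum, ← Finset.sum_neg_distrib, ← Finset.sum_add_distrib]
      refine Finset.sum_congr rfl fun k _ => ?_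
      rw [hψ']
      ring
    rw [e1]
    have e3 : (∑ j, c j) ^ 2 = (∑ j, c j) * ∑ k, c k := sq _
    nlinarith [key, e2, e3]

/-- **Berg–Christensen–Ressel 1984, Ch. 4 Prop. 3.15 — CORRECTED statement, proved.**  Same
shape as the tree's named fact `BergChristensenRessel1984_prop_4_3_15` (file
`BoundedNegDefFunctions.lean`), whose mass bound `m ≤ ⨆ s, |ψ s|` is false as printed (BCR's
proof reduces to `ψ(0) = 0` "without loss of generality", which is invalid for that bound —
counterexample `ψ = (−1, 1, 1)` on `ℤ/3`, see `not_BergChristensenRessel1984_prop_4_3_15`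
there); undoing the WLOG, the printed proof yields exactly the bound recorded here,
`m ≤ ⨆ s, |ψ s − ψ 0| = ‖ψ − ψ(0)‖_∞`: if `(x, y) ↦ ψ (y − x)` is negative definite on an
abelian group and `ψ` is bounded, then `ψ = ψ 0 + m − φ` with `(x, y) ↦ φ (y − x)` positive
definite, `φ 0 = m`, `0 ≤ m ≤ ⨆ s, |ψ s − ψ 0|`.
[cite: BergChristensenRessel1984, Ch. 4 Prop. 3.15 (PDF p. 105), bound corrected to ‖ψ − ψ(0)‖∞] -/
theorem BergChristensenRessel1984_prop_4_3_15_corrected :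
    ∀ (G : Type) [AddCommGroup G] (ψ : G → ℝ), IsNegDefKernel (fun x y : G => ψ (y - x)) →
      (∃ B : ℝ, ∀ s, |ψ s| ≤ B) →
        ∃ (m : ℝ) (φ : G → ℝ), IsPosDefKernel (fun x y : G => φ (y - x)) ∧ φ 0 = m ∧ 0 ≤ m ∧
          m ≤ (⨆ s, |ψ s - ψ 0|) ∧ ∀ s, ψ s = ψ 0 + m - φ s := by
  intro G _ ψ hψ hbdd
  obtain ⟨B, hB⟩ := hbdd
  have hbdd' : BddAbove (Set.range fun s => |ψ s - ψ 0|) := by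
    refine ⟨B + B, ?_⟩
    rintro _ ⟨s, rfl⟩
    exact (abs_sub _ _).trans (add_le_add (hB s) (hB 0))
  have hle : ∀ s, ψ s ≤ ψ 0 + ⨆ s, |ψ s - ψ 0| := fun s => by
    have h1 : |ψ s - ψ 0| ≤ ⨆ s, |ψ s - ψ 0| := le_ciSup hbdd' s
    have h2 := le_abs_self (ψ s - ψ 0)
    linarith
  have h0 : (0 : ℝ) ≤ ⨆ s, |ψ s - ψ 0| := by
    have h1 : |ψ 0 - ψ 0| ≤ ⨆ s, |ψ s - ψ 0| := le_ciSup hbdd' 0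
    simpa using h1
  exact ⟨⨆ s, |ψ s - ψ 0|, fun s => ψ 0 + (⨆ s, |ψ s - ψ 0|) - ψ s,
    isPosDefKernel_const_sub_of_isNegDefKernel ψ hψ hle, by ring, h0, le_rfl, fun s => by ring⟩

/-- **Berg–Christensen–Ressel 1984, Ch. 4 Prop. 3.15 as printed, in the range where it holds**:
under the extra hypothesis `0 ≤ ψ 0` (the case covered by the printed "WLOG `ψ(0) = 0`", since
then `‖ψ − ψ(0)‖_∞ ≤ ‖ψ‖_∞` by Cor. 4.3.2) the conclusion of the tree's named fact
`BergChristensenRessel1984_prop_4_3_15` holds verbatim: `ψ = ψ 0 + m − φ` with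
`(x, y) ↦ φ (y − x)` positive definite, `φ 0 = m` and `0 ≤ m ≤ ⨆ s, |ψ s|`.
[cite: BergChristensenRessel1984, Ch. 4 Prop. 3.15 (PDF p. 105)] -/
theorem BergChristensenRessel1984_prop_4_3_15_of_nonneg :
    ∀ (G : Type) [AddCommGroup G] (ψ : G → ℝ), IsNegDefKernel (fun x y : G => ψ (y - x)) →
      (∃ B : ℝ, ∀ s, |ψ s| ≤ B) → 0 ≤ ψ 0 →
        ∃ (m : ℝ) (φ : G → ℝ), IsPosDefKernel (fun x y : G => φ (y - x)) ∧ φ 0 = m ∧ 0 ≤ m ∧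
          m ≤ (⨆ s, |ψ s|) ∧ ∀ s, ψ s = ψ 0 + m - φ s := by
  intro G _ ψ hψ hbdd hψ0
  obtain ⟨B, hB⟩ := hbdd
  have hbdd' : BddAbove (Set.range fun s => |ψ s|) := ⟨B, by rintro _ ⟨s, rfl⟩; exact hB s⟩
  have hle : ∀ s, ψ s ≤ ⨆ s, |ψ s| := fun s => (le_abs_self _).trans (le_ciSup hbdd' s)
  have hM0 : ψ 0 ≤ ⨆ s, |ψ s| := hle 0
  exact ⟨(⨆ s, |ψ s|) - ψ 0, fun s => (⨆ s, |ψ s|) - ψ s,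
    isPosDefKernel_const_sub_of_isNegDefKernel ψ hψ hle, by ring, by linarith, by linarith,
    fun s => by ring⟩

end Main

end Literature.Analysis.Matrix

end
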